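import Summits.HodgeConjecture.HodgeConjecture.Theorems.MarkmanPartnerTransportPicardThreeK3SquaresRealMultiplicationRanks
import Summits.HodgeConjecture.HodgeConjecture.Theorems.MarkmanPartnerTransportPicardThreeK3SquaresOneCycleOddPicard
import Summits.HodgeConjecture.HodgeConjecture.Theorems.MarkmanPartnerTransportPicardThreeK3SquaresSemiregularSeed
import Literature.AlgebraicGeometry.Motives.HodgeStructureK3TypeOddRank
import Literature.AlgebraicGeometry.Motives.HodgeStructureEndomorphismFieldAdjointConj

/-!
# Route MarkmanPartnerTransport · crux `PicardThreeK3Squares` (stmt-HodgeConjecture-19652) — «SEPTIC RIGIDITY»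
# (chapter ROUTE-P1AL «HECKE SOURCES», Lemma H2, on abstract carriers): a K3-type Hodge structure of rank `≤ 21`
# whose endomorphism field has degree divisible by `7` has rank `21` with `E` totally real SEPTIC (`ℓ = 3`)
# or rank `14` with `E` of degree `14` NOT totally real (the CM point)

Planner p1 g39 (HECKE-NOTE (H2) «septic rigidity», 2026-08-28T15:45Z; lit §132: «elementary, not in print»), prover seat
hodge-nonav-19716-p2 (gen 7). For an irreducible polarized `ℚ`-Hodge structure `H` of K3 type on `V` (`dim_ℚ V ≤ 21`,
as for the transcendental lattice `T(S)_ℚ` of a projective K3 surface, `dim T = 22 − ρ(S) ≤ 21`) whose endomorphism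
field `E = End_Hdg(V)` (a number field, Zarhin) has `7 ∣ [E : ℚ]` — e.g. `E` contains a septic field `F`, the Hecke
field of a Frobenius pair `(ℤ∕p ⋊ C_e, C_e)` with `(p − 1)∕e = 7` — exactly two shapes survive:

* `finrank_eq_of_seven_dvd` — **either `dim_ℚ V = 21`, `[E:ℚ] = 7` and `E` is totally real (so `ℓ = dim_E V = 3`: the
  crux-#5 cell `(2,7)`, `ρ(S) = 1`), or `dim_ℚ V = 14`, `[E:ℚ] = 14` and `E` is NOT totally real (a CM point,
  `ℓ = 1`: `ρ(S) = 8`, the septic-seed shape of ROUTE-P1AK §A(6))**. Proof: `[E:ℚ] ∣ dim V ≤ 21`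
  (`finrank_endAlg_dvd_finrank`), so `[E:ℚ] ∈ {7, 14, 21}`; if `E` is totally real, van Geemen's Lemma 3.2
  (`RealMultiplicationRanks.exists_three_le_finrank_eq_mul`: `dim V = [E:ℚ] · m`, `m ≥ 3`) forces `(7, 3)`; if not, some
  Hodge endomorphism is moved by the Rosati involution (`adjointEndAlg_eq_self_iff_of_isField`), so `[E:ℚ]` is even
  (`even_finrank_endAlg_of_adjoint_ne`, Huybrechts §3.5), forcing `14 = 14 · 1`.
* `finrank_eq_twentyone_of_seven_dvd_of_totallyReal`, `finrank_eq_fourteen_of_seven_dvd_of_not_totallyReal` — the two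
  branches separately; `finrank_eq_fourteen_or_twentyone_of_seven_dvd` — the rank dichotomy `dim_ℚ V ∈ {14, 21}` alone
  (in K3 terms `ρ(S) ∈ {8, 1}`; for a marked surface read it on the period datum, `dim_ℚ T(S) = 22 − ρ(S)`).

* the `ρ(S) = 1` corollaries used by the Hecke ∕ seed socket (p1 g39 16:03:15Z): `forall_conj_eq_of_finrank_eq_twentyone`
  and `finrank_endAlg_mem_of_finrank_eq_twentyone` — **`dim_ℚ V = 21 ⟹ E totally real ∧ [E:ℚ] ∈ {1, 3, 7}`** (odd rank
  kills CM by the parity lemma, `forall_conj_apply_eq_of_odd_finrank`; `3[E:ℚ] ≤ 21`); `finrank_endAlg_prime_of_finrank_eq_twentyone`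
  — if moreover `E ≠ ℚ` then `[E:ℚ] ∈ {3, 7}` is PRIME (so `E = ℚ(a)` for every irrational `a ∈ E`: no intermediate field);
  and on the surface: `hodgeConjectureFor_square_of_oneCycle_picard_one` (a projective K3 `S` with `ρ(S) = 1` carrying ONE
  rational Hodge endomorphism induced by an ALGEBRAIC class on `S × S` with an irrational `(2,0)`-eigenvalue satisfies
  HC⁴(S × S) — markings only; `OneCycle.hodgeConjectureFor_square_of_oneCycle_of_odd_picard` at `ρ = 1`), and its
  SEEDED form `hodgeConjectureFor_square_of_semiregularSeed_picard_one` (the class carries a semiregular seed package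
  `SRSeed`, made algebraic by `SemiregularSeed.mem_algebraicClasses_of_srSeed`; mod {markings, `BlochSemiregularSpread 4 2`}).

Fact-free on the abstract carriers (the inputs `Zarhin1983_endAlg_isField_holds`, `Vangeemen2008_three_mul_finrank_endAlg_le_holds`
are tree THEOREMS); the surface statements take `Huybrechts_K3_marking_exists` (and Bloch∕BF for the seeded form); no
definition, no sorry; `--supports stmt-HodgeConjecture-19652`. A bookkeeping lemma for the Hecke-source
search (which Picard numbers a septic Hecke field can visit); nothing here proves the crux or HC; rung F-H1 not moved.

References: B. van Geemen, Michigan Math. J. 56 (2008) Lemma 3.2; D. Huybrechts, *Lectures on K3 Surfaces*, Ch. 3 §3.5,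
Cor. 3.3.6; Yu. G. Zarhin, J. reine angew. Math. 341 (1983) Thm. 1.5.1; J. Ellenberg, Adv. Math. 162 (2001) §2.
-/

set_option linter.dupNamespace false

noncomputable section

universe u

namespace Summit.HodgeConjecture.HodgeConjecture.Theorems.MarkmanPartnerTransport.SepticRigidity

open Module CategoryTheory MonoidalCategory CartesianMonoidalCategory AlgebraicGeometry
open Literature.AlgebraicGeometry Literature.AlgebraicGeometry.Motives Literature.AlgebraicGeometry.HodgeTheory
open Literature.AlgebraicGeometry.Motives.HodgeStructure
open Literature.AlgebraicGeometry.Surfaces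
open Literature.AlgebraicTopology.SingularHomology
open Summit.HodgeConjecture.HodgeConjecture.Theorems.MarkmanPartnerTransport.RealMultiplicationRanks
open Summit.HodgeConjecture.HodgeConjecture.Theorems.MarkmanPartnerTransport.OneCycle
open Summit.HodgeConjecture.HodgeConjecture.Theorems.MarkmanPartnerTransport.SemiregularSeed

variable {V : Type u} [AddCommGroup V] [Module ℚ V] [Module.Finite ℚ V] {H : HodgeStructure V 2}

/-- **The totally real branch**: `H` irreducible of K3 type, polarized, `E = End_Hdg(V)` totally real with `7 ∣ [E:ℚ]`
and `dim_ℚ V ≤ 21` ⟹ `dim_ℚ V = 21` and `[E:ℚ] = 7` (so `dim_E V = 3`). Van Geemen's Lemma 3.2 (`m ≥ 3`).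
[cite: Vangeemen2008, Lemma 3.2] [cite: Huybrechts2016K3, Ch. 3 §3.5 (3.2)] -/
theorem finrank_eq_twentyone_of_seven_dvd_of_totallyReal (hirr : H.IsIrreducible) (hK3 : H.IsOfK3Type)
    (ψ : H.Polarization) (h7 : 7 ∣ Module.finrank ℚ H.endAlg) (h21 : Module.finrank ℚ V ≤ 21)
    (hreal : ∀ (φ : H.endAlg →+* ℂ) (a : H.endAlg), starRingEnd ℂ (φ a) = φ a) :
    Module.finrank ℚ V = 21 ∧ Module.finrank ℚ H.endAlg = 7 := by
  have hF : IsField H.endAlg := (Zarhin1983_endAlg_isField_holds H hirr hK3).1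
  haveI : Nontrivial V := hirr.nontrivial
  obtain ⟨m, hm3, hdim⟩ := exists_three_le_finrank_eq_mul hirr hK3 ψ hF hreal
  obtain ⟨k, hk⟩ := h7
  have h1 := one_le_finrank_endAlg H
  -- `dim V = 7 k m ≤ 21`, `k ≥ 1`, `m ≥ 3` ⟹ `k = 1`, `m = 3`
  rw [hk] at hdim h1 ⊢
  have hk1 : 1 ≤ k := by omega
  have hkm : k * m ≤ 3 := by nlinarith
  have hk1' : k = 1 := by nlinarith
  subst hk1'
  constructor <;> omega

/-- **The CM branch**: `H` irreducible of K3 type, polarized, `E = End_Hdg(V)` NOT totally real with `7 ∣ [E:ℚ]` and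
`dim_ℚ V ≤ 21` ⟹ `dim_ℚ V = 14` and `[E:ℚ] = 14` (so `dim_E V = 1`): a non-real value `φ a` means `a† ≠ a`
for the Rosati involution (`adjointEndAlg_eq_self_iff_of_isField`), so `[E:ℚ]` is even (`even_finrank_endAlg_of_adjoint_ne`),
and `[E:ℚ] ∣ dim V ≤ 21` (`finrank_endAlg_dvd_finrank`). [cite: Huybrechts2016K3, Ch. 3 §3.5 and Cor. 3.3.6]
[cite: Zarhin1983HodgeGroupsK3, Thm. 1.5.1] -/
theorem finrank_eq_fourteen_of_seven_dvd_of_not_totallyReal (hirr : H.IsIrreducible) (hK3 : H.IsOfK3Type)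
    (ψ : H.Polarization) (h7 : 7 ∣ Module.finrank ℚ H.endAlg) (h21 : Module.finrank ℚ V ≤ 21)
    (hcm : ∃ (φ : H.endAlg →+* ℂ) (a : H.endAlg), starRingEnd ℂ (φ a) ≠ φ a) :
    Module.finrank ℚ V = 14 ∧ Module.finrank ℚ H.endAlg = 14 := by
  have hF : IsField H.endAlg := (Zarhin1983_endAlg_isField_holds H hirr hK3).1
  haveI : Nontrivial V := hirr.nontrivial
  obtain ⟨φ, a, ha⟩ := hcm
  have hadj : ψ.adjointEndAlg a ≠ a := fun h => ha ((adjointEndAlg_eq_self_iff_of_isField hF ψ φ a).1 h)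
  obtain ⟨r, hr⟩ := even_finrank_endAlg_of_adjoint_ne hirr hK3 ψ hadj
  obtain ⟨m, hm⟩ := finrank_endAlg_dvd_finrank hirr hK3
  obtain ⟨k, hk⟩ := h7
  have h1 := one_le_finrank_endAlg H
  have hV : 0 < Module.finrank ℚ V := Module.finrank_pos
  -- `[E:ℚ] = 7k = 2r`, `dim V = 7 k m ≤ 21`, `m ≥ 1` ⟹ `k = 2`, `m = 1`
  rw [hk] at hr hm h1 ⊢
  rw [hm] at h21 hV ⊢
  have hm1 : 1 ≤ m := by
    rcases Nat.eq_zero_or_pos m with h0 | h0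
    · rw [h0, mul_zero] at hV; exact absurd hV (lt_irrefl 0)
    · exact h0
  have hk1 : 1 ≤ k := by omega
  have hkm : k * m ≤ 3 := by nlinarith
  have hk3 : k ≤ 3 := by nlinarith
  have hkeven : k = 2 := by omega
  subst hkeven
  have hm1' : m = 1 := by omega
  subst hm1'
  constructor <;> omega

/-- **«SEPTIC RIGIDITY» (HECKE-NOTE Lemma H2, abstract carriers).** For an irreducible polarized `ℚ`-Hodge structure of
K3 type on `V` with `dim_ℚ V ≤ 21` and `7 ∣ [End_Hdg(V) : ℚ]`: either `dim_ℚ V = 21`, `[E:ℚ] = 7` and `E` is totally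
real (`ℓ = 3`, the RM cell `(2,7)` at `ρ(S) = 1`), or `dim_ℚ V = 14`, `[E:ℚ] = 14` and `E` is not totally real (CM,
`ℓ = 1`, `ρ(S) = 8`). No third Picard number carries a septic subfield of `E(S)`. Fact-free.
[cite: Vangeemen2008, Lemma 3.2] [cite: Huybrechts2016K3, Ch. 3 §3.5 and Cor. 3.3.6] -/
theorem finrank_eq_of_seven_dvd (hirr : H.IsIrreducible) (hK3 : H.IsOfK3Type) (ψ : H.Polarization)
    (h7 : 7 ∣ Module.finrank ℚ H.endAlg) (h21 : Module.finrank ℚ V ≤ 21) :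
    (Module.finrank ℚ V = 21 ∧ Module.finrank ℚ H.endAlg = 7 ∧
        ∀ (φ : H.endAlg →+* ℂ) (a : H.endAlg), starRingEnd ℂ (φ a) = φ a) ∨
      (Module.finrank ℚ V = 14 ∧ Module.finrank ℚ H.endAlg = 14 ∧
        ∃ (φ : H.endAlg →+* ℂ) (a : H.endAlg), starRingEnd ℂ (φ a) ≠ φ a) := by
  by_cases hreal : ∀ (φ : H.endAlg →+* ℂ) (a : H.endAlg), starRingEnd ℂ (φ a) = φ a
  · obtain ⟨hV, hE⟩ := finrank_eq_twentyone_of_seven_dvd_of_totallyReal hirr hK3 ψ h7 h21 hreal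
    exact Or.inl ⟨hV, hE, hreal⟩
  · push Not at hreal
    obtain ⟨hV, hE⟩ := finrank_eq_fourteen_of_seven_dvd_of_not_totallyReal hirr hK3 ψ h7 h21 hreal
    exact Or.inr ⟨hV, hE, hreal⟩

/-- **The excluded ranks**: under the same hypotheses `dim_ℚ V ∈ {14, 21}` — in K3 terms `ρ(S) ∈ {1, 8}`; every other
Picard number is free of septic Hecke fields. [cite: Vangeemen2008, Lemma 3.2] [cite: Huybrechts2016K3, Ch. 3 §3.5] -/
theorem finrank_eq_fourteen_or_twentyone_of_seven_dvd (hirr : H.IsIrreducible) (hK3 : H.IsOfK3Type)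
    (ψ : H.Polarization) (h7 : 7 ∣ Module.finrank ℚ H.endAlg) (h21 : Module.finrank ℚ V ≤ 21) :
    Module.finrank ℚ V = 14 ∨ Module.finrank ℚ V = 21 := by
  rcases finrank_eq_of_seven_dvd hirr hK3 ψ h7 h21 with ⟨h, -, -⟩ | ⟨h, -, -⟩
  · exact Or.inr h
  · exact Or.inl h

/-! ### The rank-`21` corollaries (`ρ(S) = 1`): no CM, `[E:ℚ] ∈ {1, 3, 7}`, prime when `E ≠ ℚ` -/

/-- **Rank `21` ⟹ totally real endomorphism field** (odd rank: a non-real value would make `[E:ℚ]` even, but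
`[E:ℚ] ∣ 21`; the tree's `forall_conj_apply_eq_of_odd_finrank`). In K3 terms: no complex multiplication at `ρ(S) = 1`.
[cite: Huybrechts2016K3, Ch. 3 Rem. 3.3.14 (ii)] -/
theorem forall_conj_eq_of_finrank_eq_twentyone (hirr : H.IsIrreducible) (hK3 : H.IsOfK3Type) (ψ : H.Polarization)
    (h21 : Module.finrank ℚ V = 21) (φ : H.endAlg →+* ℂ) (a : H.endAlg) : starRingEnd ℂ (φ a) = φ a :=
  forall_conj_apply_eq_of_odd_finrank hirr hK3 ψ (by rw [h21]; decide) φ a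

/-- **Rank `21` ⟹ `[E:ℚ] ∈ {1, 3, 7}`**: `[E:ℚ] ∣ 21` (`finrank_endAlg_dvd_finrank`) and `3 · [E:ℚ] ≤ 21` (odd rank ⟹
totally real ⟹ van Geemen's `dim_E V ≥ 3`, `three_mul_finrank_endAlg_le_of_odd_finrank`), so `[E:ℚ] ≠ 21`.
[cite: Vangeemen2008, Lemma 3.2] [cite: Huybrechts2016K3, Ch. 3 §3.5 (3.2)] -/
theorem finrank_endAlg_mem_of_finrank_eq_twentyone (hirr : H.IsIrreducible) (hK3 : H.IsOfK3Type)
    (ψ : H.Polarization) (h21 : Module.finrank ℚ V = 21) :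
    Module.finrank ℚ H.endAlg = 1 ∨ Module.finrank ℚ H.endAlg = 3 ∨ Module.finrank ℚ H.endAlg = 7 := by
  have hodd : Odd (Module.finrank ℚ V) := by rw [h21]; decide
  have h3 := three_mul_finrank_endAlg_le_of_odd_finrank hirr hK3 ψ hodd
  obtain ⟨m, hm⟩ := finrank_endAlg_dvd_finrank hirr hK3
  rw [h21] at h3 hm
  have hle : Module.finrank ℚ H.endAlg ≤ 7 := by omega
  -- the divisors of `21` that are `≤ 7`
  have hE : Module.finrank ℚ H.endAlg ∣ 21 := ⟨m, hm⟩
  interval_cases h : Module.finrank ℚ H.endAlg <;> simp_all <;> omega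

/-- **Rank `21` and `E ≠ ℚ` ⟹ `[E:ℚ] ∈ {3, 7}`, a PRIME** — so for an irrational `a ∈ E` (one exists iff `E ≠ ℚ`) the
subfield `ℚ(a)` is all of `E`: «one irrational eigenvalue at `ρ(S) = 1` has minimal polynomial of degree `3` or `7` and
generates `E`» (the Hecke-source shape of cells `(2,3)` and `(2,7)` on the K3 side). [cite: Vangeemen2008, Lemma 3.2]
[cite: Huybrechts2016K3, Ch. 3 §3.5 (3.2) and Rem. 3.3.14 (ii)] -/
theorem finrank_endAlg_prime_of_finrank_eq_twentyone (hirr : H.IsIrreducible) (hK3 : H.IsOfK3Type)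
    (ψ : H.Polarization) (h21 : Module.finrank ℚ V = 21) (hE : H.endAlg ≠ ⊥) :
    (Module.finrank ℚ H.endAlg = 3 ∨ Module.finrank ℚ H.endAlg = 7) ∧ (Module.finrank ℚ H.endAlg).Prime := by
  have h1 : Module.finrank ℚ H.endAlg ≠ 1 := fun h => hE (Subalgebra.eq_bot_of_finrank_one h)
  rcases finrank_endAlg_mem_of_finrank_eq_twentyone hirr hK3 ψ h21 with h | h | h
  · exact absurd h h1
  · exact ⟨Or.inl h, by rw [h]; exact Nat.prime_three⟩
  · exact ⟨Or.inr h, by rw [h]; exact (by norm_num : Nat.Prime 7)⟩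

/-! ### On the surface: the one-cycle ∕ seed socket at `ρ(S) = 1` -/

variable {S : SchemeOver ℂ}

/-- `Res[f, s, k, A] = A|_{𝒳_s}` (VERBATIM `…OrphanSR`). Local notation only. -/
local notation3 (prettyPrint := false) "Res[" f ", " s ", " k ", " A "]" =>
  complexBetti.map (Motives.fiberι f s) k A

/-- `SRSeed[S ; γ]`: a semiregular seed package for `γ ∈ H⁴((S ⊗ S)(ℂ); ℂ)` (VERBATIM `…PicardThreeK3SquaresSemiregularSeed`).
Local notation only. -/
local notation3 (prettyPrint := false) "SRSeed[" S " ; " γ "]" =>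
  (∃ (X₀ : SchemeOver ℂ) (Z : Scheme.{0}) (i : Z ⟶ X₀.left) (x : complexBetti X₀ (2 * 2))
    (𝒳 B : SchemeOver ℂ) (f : 𝒳 ⟶ B) (s₀ t₁ : ComplexPoints B) (e₀ : X₀ ≅ fiberOver f s₀)
    (e₁ : S ⊗ S ≅ fiberOver f t₁) (W : complexBetti 𝒳 (2 * 2)),
    IsClosedImmersion i ∧ IsRegularImmersionOfCodim i 2 ∧ AlgebraicGeometry.IsIntegral Z ∧
    (∀ z ∈ Set.range i.base, (2 : ℕ∞) ≤ Order.coheight z) ∧ IsBlochSemiregular i 4 2 ∧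
    x ∈ classesSupportedOn X₀ (Set.range i.base) (2 * 2) ∧
    IsSmoothProjectiveFamily f 4 ∧ IsQuasiProjectiveOver 𝒳 ∧ IsQuasiProjectiveOver B ∧
    AlgebraicGeometry.Smooth B.hom ∧ ConnectedSpace (ComplexPoints B) ∧
    (∀ s : ComplexPoints B, IsRationalClass (Res[f, s, 2 * 2, W]) ∧
      IsOfHodgeType 4 (fiberOver f s) (2 * 2) 2 2 (Res[f, s, 2 * 2, W])) ∧
    complexBetti.map e₀.hom (2 * 2) (Res[f, s₀, 2 * 2, W]) = x ∧
    complexBetti.map e₁.hom (2 * 2) (Res[f, t₁, 2 * 2, W]) - γ ∈ algebraicClasses (S ⊗ S) 2)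

/-- `Corr[hS ; γ, y] = fst_*(snd^* y ∪ γ)` on `H²(S(ℂ); ℂ)`, complex orientations (VERBATIM `…AlgebraicLocusSpread`).
Local notation only. -/
local notation3 (prettyPrint := false) "Corr[" hS " ; " γ ", " y "]" =>
  complexGysin complexOrientationFamily (IsSmoothProjective.tensor_holds hS hS) hS
    (SemiCartesianMonoidalCategory.fst _ _) (rfl : 2 * 1 + 2 * 2 + 2 * 2 = 2 * 1 + 2 * (2 + 2))
    (cupProduct (rfl : 2 * 1 + 2 * 2 = 2 * 1 + 2 * 2)
      (complexBetti.map (SemiCartesianMonoidalCategory.snd _ _) (2 * 1) y) γ)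

/-- **ONE CYCLE SUFFICES AT `ρ(S) = 1` (markings only).** A projective K3 surface `S` of Picard number `1` carrying ONE
endomorphism of `H²(S(ℂ); ℂ)` that preserves rational classes and Hodge types, is induced by an ALGEBRAIC class on `S × S`,
and has a non-rational eigenvalue on a non-zero `(2,0)`-class, satisfies `HodgeConjectureFor 4 (S ⊗ S)`: `ρ = 1` is odd,
so `OneCycle.hodgeConjectureFor_square_of_oneCycle_of_odd_picard` applies (no CM at odd Picard number; the
admissible degrees `3`, `7` are prime, so the one endomorphism generates `E(S)`). This is the K3-side socket a HECKE
source at `ρ(S) = 1` (cells `(2,3)`, `(2,7)` of crux #5 through the partner) feeds VERBATIM — Hecke correspondences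
are algebraic classes on `S × S` by construction. [cite: GeemenSchutt2023, §4.8 and Rem. 4.9]
[cite: Huybrechts2016K3, Ch. 3 Rem. 3.3.14 (ii)] [cite: Vangeemen2008, Lemma 3.2] -/
theorem hodgeConjectureFor_square_of_oneCycle_picard_one (hmark : Huybrechts_K3_marking_exists) (hS : IsK3Surface S)
    (hρ : Module.finrank ℂ ↥(algebraicClasses S 1) = 1)
    (e : complexBetti S (2 * 1) →ₗ[ℂ] complexBetti S (2 * 1))
    (he_rat : ∀ y, IsRationalClass y → IsRationalClass (e y))
    (he_typ : ∀ (i j : ℕ) y, IsOfHodgeType 2 S (2 * 1) i j y → IsOfHodgeType 2 S (2 * 1) i j (e y))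
    (he_cyc : ∃ γ ∈ algebraicClasses (S ⊗ S) 2, ∀ y : complexBetti S (2 * 1),
      e y = Corr[hS.isSmoothProjective ; γ, y])
    (he_ev : ∃ (σ₀ : complexBetti S (2 * 1)) (ev : ℂ), IsOfHodgeType 2 S (2 * 1) 2 0 σ₀ ∧ σ₀ ≠ 0 ∧
      e σ₀ = ev • σ₀ ∧ ∀ a : ℚ, (a : ℂ) ≠ ev) :
    HodgeConjectureFor 4 (S ⊗ S) :=
  hodgeConjectureFor_square_of_oneCycle_of_odd_picard hmark hS (by rw [hρ]; exact odd_one) complexOrientationFamily e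
    he_rat he_typ he_cyc he_ev

/-- **THE SEEDED SOCKET AT `ρ(S) = 1`.** As `hodgeConjectureFor_square_of_oneCycle_picard_one`, with the algebraicity of the
inducing class `γ` supplied by a SEMIREGULAR SEED PACKAGE (`SRSeed`, Bloch 1972 Thm. 7.4 ∕ Buchweitz–Flenner 2003 Thm. 5.2
through `SemiregularSeed.mem_algebraicClasses_of_srSeed`). Mod {markings, `BlochSemiregularSpread 4 2`}; CONDITIONAL on the
seed (none in print); credits nothing to HC. [cite: BuchweitzFlenner2003, Thm. 5.2] [cite: GeemenSchutt2023, §4.8 and Rem. 4.9] -/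
theorem hodgeConjectureFor_square_of_semiregularSeed_picard_one (hmark : Huybrechts_K3_marking_exists)
    (hBl : BlochSemiregularSpread 4 2) (hS : IsK3Surface S) (hρ : Module.finrank ℂ ↥(algebraicClasses S 1) = 1)
    (e : complexBetti S (2 * 1) →ₗ[ℂ] complexBetti S (2 * 1))
    (he_rat : ∀ y, IsRationalClass y → IsRationalClass (e y))
    (he_typ : ∀ (i j : ℕ) y, IsOfHodgeType 2 S (2 * 1) i j y → IsOfHodgeType 2 S (2 * 1) i j (e y))
    {γ : complexBetti (S ⊗ S) (2 * 2)} (he_γ : ∀ y : complexBetti S (2 * 1), e y = Corr[hS.isSmoothProjective ; γ, y])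
    (hseed : SRSeed[S ; γ])
    (he_ev : ∃ (σ₀ : complexBetti S (2 * 1)) (ev : ℂ), IsOfHodgeType 2 S (2 * 1) 2 0 σ₀ ∧ σ₀ ≠ 0 ∧
      e σ₀ = ev • σ₀ ∧ ∀ a : ℚ, (a : ℂ) ≠ ev) :
    HodgeConjectureFor 4 (S ⊗ S) :=
  hodgeConjectureFor_square_of_oneCycle_picard_one hmark hS hρ e he_rat he_typ
    ⟨γ, mem_algebraicClasses_of_srSeed hBl hseed, he_γ⟩ he_ev

end Summit.HodgeConjecture.HodgeConjecture.Theorems.MarkmanPartnerTransport.SepticRigidity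

end
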